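import Summits.Ventures.PercRepro.Night2ShapeOneSideA
import Summits.Ventures.PercRepro.Night2ShapeOneSideB
import Summits.Ventures.PercRepro.Night2ShapeOneSideC
import Summits.Ventures.PercRepro.Night2ShapeOneSideD

/-!
# PercRepro — the seven-point shape (i): THE TWO-SIDED FINITE CHECK in the H-fat regime (night-2, gen 30)

The two lines `ℓ₁`, `ℓ₂` of a seven-point one-coloop target share the outside points (proofs/NIGHT-2-g30.md §4): an
`E`-point (in `H`) is on `ℓ₁` (free on side `1`, invisible on side `2`; count `e1o`), on `ℓ₂` (`e2o`), or visible on both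
sides (`eb`, of which `eb01` are free on side `1` and `eb02` free on side `2`); in the H-FAT regime (`m_H = 2`) there is
exactly ONE point off `H`, visible (and good for all sources) on at least one side, and the capacity `23/72` is the
target's only when `|Out| ≥ 4`, i.e. `|E| ≥ 3`.  **`shapeOne_couplingHF`**: under these relations the six losses of the
two sides, split over their good points, sum to at most `23/72` — the case analysis of §4.1 on where the `Z`-point is
visible and on the numbers of visible points, with the per-side bounds of Night2ShapeOneSideA–D.  The extremal
configuration (`319/345` of the capacity) is the case «side `2` = two points attached to two different faces, side `1` =
a free point, a visible `Z`-point and at least four visible points» (`P1 + B12 = 23/90 + 23/360`).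
-/

namespace PercRepro.Shadow

section Coupling

variable {e1o e2o eb eb01 eb02 : ℕ}
variable {fE₁ a₁ a₂ a₃ zf₁ z₁ z₂ z₃ s₁ s₂ s₃ g₁ g₂ g₃ : ℕ} {r₁ r₂ r₃ : ℚ}
variable {fE₂ b₁ b₂ b₃ zf₂ y₁ y₂ y₃ t₁ t₂ t₃ h₁ h₂ h₃ : ℕ} {u₁ u₂ u₃ : ℚ}

set_option maxHeartbeats 1600000 in
/-- **The H-fat coupling, the `Z`-point visible on side `1`.** -/
theorem shapeOne_couplingHF_A
    (hE : 3 ≤ e1o + e2o + eb) (hfE₁ : fE₁ = e1o + eb01) (hab : eb = eb01 + (a₁ + a₂ + a₃))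
    (hfE₂ : fE₂ = e2o + eb02) (hbb : eb = eb02 + (b₁ + b₂ + b₃))
    (hz₁ : zf₁ + (z₁ + z₂ + z₃) ≤ 1) (hz₂ : zf₂ + (y₁ + y₂ + y₃) ≤ 1) (hζ₁ : 1 ≤ zf₁ + (z₁ + z₂ + z₃))
    (hs₁ : s₁ = fE₁ + zf₁ + (a₂ + z₂) + (a₃ + z₃)) (hs₂ : s₂ = fE₁ + zf₁ + (a₁ + z₁) + (a₃ + z₃))
    (hs₃ : s₃ = fE₁ + zf₁ + (a₁ + z₁) + (a₂ + z₂))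
    (hg₁ : g₁ = 1 + fE₁ + a₁ + zf₁ + (z₁ + z₂ + z₃)) (hg₂ : g₂ = 1 + fE₁ + a₂ + zf₁ + (z₁ + z₂ + z₃))
    (hg₃ : g₃ = 1 + fE₁ + a₃ + zf₁ + (z₁ + z₂ + z₃))
    (hr₁ : r₁ ≤ rhoReq (2 + s₁)) (h₁0 : s₁ = 0 → r₁ = 0) (hr₂ : r₂ ≤ rhoReq (2 + s₂)) (h₂0 : s₂ = 0 → r₂ = 0)
    (hr₃ : r₃ ≤ rhoReq (2 + s₃)) (h₃0 : s₃ = 0 → r₃ = 0)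
    (ht₁ : t₁ = fE₂ + zf₂ + (b₂ + y₂) + (b₃ + y₃)) (ht₂ : t₂ = fE₂ + zf₂ + (b₁ + y₁) + (b₃ + y₃))
    (ht₃ : t₃ = fE₂ + zf₂ + (b₁ + y₁) + (b₂ + y₂))
    (hh₁ : h₁ = 1 + fE₂ + b₁ + zf₂ + (y₁ + y₂ + y₃)) (hh₂ : h₂ = 1 + fE₂ + b₂ + zf₂ + (y₁ + y₂ + y₃))
    (hh₃ : h₃ = 1 + fE₂ + b₃ + zf₂ + (y₁ + y₂ + y₃))
    (hu₁ : u₁ ≤ rhoReq (2 + t₁)) (hu₁0 : t₁ = 0 → u₁ = 0) (hu₂ : u₂ ≤ rhoReq (2 + t₂)) (hu₂0 : t₂ = 0 → u₂ = 0)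
    (hu₃ : u₃ ≤ rhoReq (2 + t₃)) (hu₃0 : t₃ = 0 → u₃ = 0) :
    (max (7 / 24 + r₂ + r₃ - 11 / 18) 0 / (g₁ : ℚ) + max (7 / 24 + r₁ + r₃ - 11 / 18) 0 / (g₂ : ℚ) +
      max (7 / 24 + r₁ + r₂ - 11 / 18) 0 / (g₃ : ℚ)) +
    (max (7 / 24 + u₂ + u₃ - 11 / 18) 0 / (h₁ : ℚ) + max (7 / 24 + u₁ + u₃ - 11 / 18) 0 / (h₂ : ℚ) +
      max (7 / 24 + u₁ + u₂ - 11 / 18) 0 / (h₃ : ℚ)) ≤ 23 / 72 := by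
  obtain ⟨hL₁, hB₁, hn₁⟩ := lossHF_props hr₂ h₂0 hr₃ h₃0
  obtain ⟨hL₂, hB₂, hn₂⟩ := lossHF_props hr₁ h₁0 hr₃ h₃0
  obtain ⟨hL₃, hB₃, hn₃⟩ := lossHF_props hr₁ h₁0 hr₂ h₂0
  obtain ⟨hM₁, hC₁, hm₁⟩ := lossHF_props hu₂ hu₂0 hu₃ hu₃0
  obtain ⟨hM₂, hC₂, hm₂⟩ := lossHF_props hu₁ hu₁0 hu₃ hu₃0
  obtain ⟨hM₃, hC₃, hm₃⟩ := lossHF_props hu₁ hu₁0 hu₂ hu₂0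
  -- the two `P1` bounds (request form)
  have P1₁ := sideHF_le_P1 hs₁ hs₂ hs₃ hg₁ hg₂ hg₃ hr₁ h₁0 hr₂ h₂0 hr₃ h₃0
  have P1₂ := sideHF_le_P1 ht₁ ht₂ ht₃ hh₁ hh₂ hh₃ hu₁ hu₁0 hu₂ hu₂0 hu₃ hu₃0
  by_cases hζ₂ : 1 ≤ zf₂ + (y₁ + y₂ + y₃)
  · -- the `Z`-point is visible on both sides
    by_cases ha : e1o + eb ≤ 1
    · -- at most one `E`-point visible on side `1`: at least two on `ℓ₂`, free on side `2`
      have S1 := sideHF_core_zeta hs₁ hs₂ hs₃ hg₁ hg₂ hg₃ hL₁ hB₁ hn₁ hL₂ hB₂ hn₂ hL₃ hB₃ hn₃ hζ₁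
      have S2 := sideHF_core_fE2_zeta ht₁ ht₂ ht₃ hh₁ hh₂ hh₃ hM₁ hC₁ hm₁ hM₂ hC₂ hm₂ hM₃ hC₃ hm₃ (by omega) hζ₂
      linarith
    · by_cases hb : e2o + eb ≤ 1
      · have S2 := sideHF_core_zeta ht₁ ht₂ ht₃ hh₁ hh₂ hh₃ hM₁ hC₁ hm₁ hM₂ hC₂ hm₂ hM₃ hC₃ hm₃ hζ₂
        have S1 := sideHF_core_fE2_zeta hs₁ hs₂ hs₃ hg₁ hg₂ hg₃ hL₁ hB₁ hn₁ hL₂ hB₂ hn₂ hL₃ hB₃ hn₃ (by omega) hζ₁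
        linarith
      · have S1 := sideHF_core_zeta_N3 hs₁ hs₂ hs₃ hg₁ hg₂ hg₃ hL₁ hB₁ hn₁ hL₂ hB₂ hn₂ hL₃ hB₃ hn₃ hζ₁ (by omega)
        have S2 := sideHF_core_zeta_N3 ht₁ ht₂ ht₃ hh₁ hh₂ hh₃ hM₁ hC₁ hm₁ hM₂ hC₂ hm₂ hM₃ hC₃ hm₃ hζ₂ (by omega)
        linarith
  · -- the `Z`-point is invisible on side `2`
    have hζ₂' : zf₂ + (y₁ + y₂ + y₃) = 0 := by omega
    by_cases ha : e1o + eb ≤ 1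
    · have S1 := sideHF_core_zeta hs₁ hs₂ hs₃ hg₁ hg₂ hg₃ hL₁ hB₁ hn₁ hL₂ hB₂ hn₂ hL₃ hB₃ hn₃ hζ₁
      have S2 := sideHF_core_fE2 ht₁ ht₂ ht₃ hh₁ hh₂ hh₃ hM₁ hC₁ hm₁ hM₂ hC₂ hm₂ hM₃ hC₃ hm₃ (by omega)
      linarith
    · by_cases ha2 : e1o + eb = 2
      · by_cases heb : eb = 0
        · -- both side-`1`-visible `E`-points are on `ℓ₁`
          have S1 := sideHF_core_fE2_zeta hs₁ hs₂ hs₃ hg₁ hg₂ hg₃ hL₁ hB₁ hn₁ hL₂ hB₂ hn₂ hL₃ hB₃ hn₃ (by omega) hζ₁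
          linarith
        · have S1 := sideHF_core_zeta_N3 hs₁ hs₂ hs₃ hg₁ hg₂ hg₃ hL₁ hB₁ hn₁ hL₂ hB₂ hn₂ hL₃ hB₃ hn₃ hζ₁ (by omega)
          have S2 := sideHF_core_fE1_N2 ht₁ ht₂ ht₃ hh₁ hh₂ hh₃ hM₁ hC₁ hm₁ hM₂ hC₂ hm₂ hM₃ hC₃ hm₃ (by omega) (by omega)
          linarith
      · -- at least three `E`-points visible on side `1`: `N₁ ≥ 4`
        have S1 := sideHF_core_zeta_N4 hs₁ hs₂ hs₃ hg₁ hg₂ hg₃ hL₁ hB₁ hn₁ hL₂ hB₂ hn₂ hL₃ hB₃ hn₃ hζ₁ (by omega)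
        rcases Nat.lt_or_ge (e2o + eb) 3 with hN2 | hN2
        swap
        · have S2 := sideHF_core_nozeta_N3 ht₁ ht₂ ht₃ hh₁ hh₂ hh₃ hM₁ hC₁ hm₁ hM₂ hC₂ hm₂ hM₃ hC₃ hm₃ hζ₂' (by omega)
          linarith
        rcases Nat.lt_or_ge (e2o + eb) 2 with hN2' | hN2'
        · -- `N₂ ≤ 1`
          by_cases hf2 : 1 ≤ fE₂
          · -- the single visible point of side `2` is free: the other `E`-points are on `ℓ₁`
            have S1' := sideHF_core_fE2_zeta hs₁ hs₂ hs₃ hg₁ hg₂ hg₃ hL₁ hB₁ hn₁ hL₂ hB₂ hn₂ hL₃ hB₃ hn₃ (by omega) hζ₁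
            linarith
          · -- side `2` sees at most one point, attached
            have hf2' : fE₂ = 0 := by omega
            rcases Nat.eq_zero_or_pos b₁ with hb1 | hb1
            · rcases Nat.eq_zero_or_pos b₂ with hb2 | hb2
              · have S2 := sideHF_core_null₃ ht₁ ht₂ ht₃ hh₁ hh₂ hh₃ hM₁ hC₁ hm₁ hM₂ hC₂ hm₂ hM₃ hC₃ hm₃ hf2' hζ₂' hb1 hb2
                linarith
              · have S2 := sideHF_core_null₂ ht₁ ht₂ ht₃ hh₁ hh₂ hh₃ hM₁ hC₁ hm₁ hM₂ hC₂ hm₂ hM₃ hC₃ hm₃ hf2' hζ₂' hb1 (by omega)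
                linarith
            · have S2 := sideHF_core_null₁ ht₁ ht₂ ht₃ hh₁ hh₂ hh₃ hM₁ hC₁ hm₁ hM₂ hC₂ hm₂ hM₃ hC₃ hm₃ hf2' hζ₂' (by omega) (by omega)
              linarith
        · -- `N₂ = 2`
          by_cases hf2 : 1 ≤ fE₂
          · have S2 := sideHF_core_fE1_N2 ht₁ ht₂ ht₃ hh₁ hh₂ hh₃ hM₁ hC₁ hm₁ hM₂ hC₂ hm₂ hM₃ hC₃ hm₃ hf2 (by omega)
            linarith
          · have hf2' : fE₂ = 0 := by omega
            -- two attached points: on one face (null) or on two faces (the extremal side, `P1`)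
            by_cases htwo : b₁ = 2 ∨ b₂ = 2 ∨ b₃ = 2
            · rcases htwo with h | h | h
              · have S2 := sideHF_core_null₁ ht₁ ht₂ ht₃ hh₁ hh₂ hh₃ hM₁ hC₁ hm₁ hM₂ hC₂ hm₂ hM₃ hC₃ hm₃ hf2' hζ₂' (by omega) (by omega)
                linarith
              · have S2 := sideHF_core_null₂ ht₁ ht₂ ht₃ hh₁ hh₂ hh₃ hM₁ hC₁ hm₁ hM₂ hC₂ hm₂ hM₃ hC₃ hm₃ hf2' hζ₂' (by omega) (by omega)
                linarith
              · have S2 := sideHF_core_null₃ ht₁ ht₂ ht₃ hh₁ hh₂ hh₃ hM₁ hC₁ hm₁ hM₂ hC₂ hm₂ hM₃ hC₃ hm₃ hf2' hζ₂' (by omega) (by omega)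
                linarith
            · -- the two attached points of side `2` are visible on side `1`; the third `E`-point is on `ℓ₁`
              have S1' := sideHF_core_fE1_zeta_N4 hs₁ hs₂ hs₃ hg₁ hg₂ hg₃ hL₁ hB₁ hn₁ hL₂ hB₂ hn₂ hL₃ hB₃ hn₃ (by omega) hζ₁ (by omega)
              linarith

/-- **THE H-FAT COUPLING** (`proofs/NIGHT-2-g30.md` §4.1): in the H-fat regime (`r_H = 7/24`, one point off `H`, visible on
at least one side, `|E| ≥ 3`, no fat `K`-face) the six losses of a seven-point shape-(i) target, split over their good
points, sum to at most the capacity `23/72`. -/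
theorem shapeOne_couplingHF
    (hE : 3 ≤ e1o + e2o + eb) (hfE₁ : fE₁ = e1o + eb01) (hab : eb = eb01 + (a₁ + a₂ + a₃))
    (hfE₂ : fE₂ = e2o + eb02) (hbb : eb = eb02 + (b₁ + b₂ + b₃))
    (hz₁ : zf₁ + (z₁ + z₂ + z₃) ≤ 1) (hz₂ : zf₂ + (y₁ + y₂ + y₃) ≤ 1)
    (hζ : 1 ≤ zf₁ + (z₁ + z₂ + z₃) + (zf₂ + (y₁ + y₂ + y₃)))
    (hs₁ : s₁ = fE₁ + zf₁ + (a₂ + z₂) + (a₃ + z₃)) (hs₂ : s₂ = fE₁ + zf₁ + (a₁ + z₁) + (a₃ + z₃))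
    (hs₃ : s₃ = fE₁ + zf₁ + (a₁ + z₁) + (a₂ + z₂))
    (hg₁ : g₁ = 1 + fE₁ + a₁ + zf₁ + (z₁ + z₂ + z₃)) (hg₂ : g₂ = 1 + fE₁ + a₂ + zf₁ + (z₁ + z₂ + z₃))
    (hg₃ : g₃ = 1 + fE₁ + a₃ + zf₁ + (z₁ + z₂ + z₃))
    (hr₁ : r₁ ≤ rhoReq (2 + s₁)) (h₁0 : s₁ = 0 → r₁ = 0) (hr₂ : r₂ ≤ rhoReq (2 + s₂)) (h₂0 : s₂ = 0 → r₂ = 0)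
    (hr₃ : r₃ ≤ rhoReq (2 + s₃)) (h₃0 : s₃ = 0 → r₃ = 0)
    (ht₁ : t₁ = fE₂ + zf₂ + (b₂ + y₂) + (b₃ + y₃)) (ht₂ : t₂ = fE₂ + zf₂ + (b₁ + y₁) + (b₃ + y₃))
    (ht₃ : t₃ = fE₂ + zf₂ + (b₁ + y₁) + (b₂ + y₂))
    (hh₁ : h₁ = 1 + fE₂ + b₁ + zf₂ + (y₁ + y₂ + y₃)) (hh₂ : h₂ = 1 + fE₂ + b₂ + zf₂ + (y₁ + y₂ + y₃))
    (hh₃ : h₃ = 1 + fE₂ + b₃ + zf₂ + (y₁ + y₂ + y₃))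
    (hu₁ : u₁ ≤ rhoReq (2 + t₁)) (hu₁0 : t₁ = 0 → u₁ = 0) (hu₂ : u₂ ≤ rhoReq (2 + t₂)) (hu₂0 : t₂ = 0 → u₂ = 0)
    (hu₃ : u₃ ≤ rhoReq (2 + t₃)) (hu₃0 : t₃ = 0 → u₃ = 0) :
    (max (7 / 24 + r₂ + r₃ - 11 / 18) 0 / (g₁ : ℚ) + max (7 / 24 + r₁ + r₃ - 11 / 18) 0 / (g₂ : ℚ) +
      max (7 / 24 + r₁ + r₂ - 11 / 18) 0 / (g₃ : ℚ)) +
    (max (7 / 24 + u₂ + u₃ - 11 / 18) 0 / (h₁ : ℚ) + max (7 / 24 + u₁ + u₃ - 11 / 18) 0 / (h₂ : ℚ) +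
      max (7 / 24 + u₁ + u₂ - 11 / 18) 0 / (h₃ : ℚ)) ≤ 23 / 72 := by
  by_cases hζ₁ : 1 ≤ zf₁ + (z₁ + z₂ + z₃)
  · exact shapeOne_couplingHF_A hE hfE₁ hab hfE₂ hbb hz₁ hz₂ hζ₁ hs₁ hs₂ hs₃ hg₁ hg₂ hg₃ hr₁ h₁0 hr₂ h₂0 hr₃ h₃0
      ht₁ ht₂ ht₃ hh₁ hh₂ hh₃ hu₁ hu₁0 hu₂ hu₂0 hu₃ hu₃0
  · have h := shapeOne_couplingHF_A (e1o := e2o) (e2o := e1o) (eb := eb) (eb01 := eb02) (eb02 := eb01)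
      (by omega) hfE₂ hbb hfE₁ hab hz₂ hz₁ (by omega) ht₁ ht₂ ht₃ hh₁ hh₂ hh₃ hu₁ hu₁0 hu₂ hu₂0 hu₃ hu₃0
      hs₁ hs₂ hs₃ hg₁ hg₂ hg₃ hr₁ h₁0 hr₂ h₂0 hr₃ h₃0
    linarith

end Coupling

end PercRepro.Shadow
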